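import Literature.MathematicalPhysics.QuantumFieldTheory.Balaban1983to89.B7Eq123General
import Literature.MathematicalPhysics.QuantumFieldTheory.Balaban1983to89.B9Eq3115KnitLetterY

/-!
# `Balaban1983to89.B7Prop4LinCovIterLinearBound` — T. Bałaban, *Averaging operations for lattice gauge theories*, Commun. Math. Phys. **98** (1985) 17–51
# [Balaban1985Averaging, "[5]" = "B7"], Proposition 4 (130)–(131) p. 38 with (122)/(127) pp. 36–37, read for the LINEAR PART ALONE: the iterated linearised
# covariant average `LʲQ_j(U₀)` is bounded by `2·Lʲ·‖A‖∞` for EVERY field `A` (no smallness of the field) in the (52) regime of the background — and hence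
# print's averaging letter `Q_j(U)` of *Propagators for lattice gauge theories in a background field*, CMP **99** (1985) [Balaban1985BackgroundPropagators, "B9"],
# (3.12)–(3.15) p. 393, in dag-n06-l's realisation `QknitY`, does not more than double sup norms: the size law (L7) of the pub-ymgap N06 Q-letter law bundle, in the
# (52) currency (director-ym №375, obligation (5) «(L7) sizes := n06-c»)

statement-level skeleton of published theorems with citation tags; proofs where landed; nothing here is a claim about the Yang–Mills mass gap

THE PRINT.  [5] Proposition 4 p. 38, (130)–(131): for `U₀` in Proposition 2's class ((52): plaquette deviations `< α₀L^{−2k}`) the iterated averages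
`Q_j(U₀, A) = Q_j(U₀)A + C_j(U₀, A)` with `|Q_j(U₀, A)| ≦ 2Lʲ|A|` (the logarithm of the nonlinear average) and `|C_j(U₀, A)| ≦ O(1)(Lʲ|A|)²` (the remainder after the
LINEAR PART `Q_j(U₀)A` of (122)/(127)), for `|A|` small; [B9] (3.14)–(3.15) p. 393: *«Q_j(U)A is a linear part …»*, *«Q_{j+1}(U) = Q(Ūʲ)Q_j(U)»*; (3.15) p. 393 (the sizes of
the averaging operators).

WHY THIS FILE (pub-ymgap node N06 [B9], O5 ∕ R2 re-pin, director-ym ruling №375 2026-08-30: the record's averaging letter is re-pinned to dag-n06-l's `QknitY` (the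
COMPOSITE linearised average of [5], for which (3.115) holds) with a law bundle `QLawsY` (node00-def-Y); law (L7) «sizes» is this seat's).  The tree's Proposition 4
(`B7Eq123General.prop4_general`, general normed algebra `𝔸`) bounds the LOGARITHM `Q_j(U₀, A)` by `2Lʲ|A|` and its distance to the linear part by `O(1)e^{cα₀}(Lʲ|A|)²`,
both under the NONLINEAR smallness of the field (`hsmall`, `hc₃` on `Lᵏ|A|`).  The linear part needs no smallness: dag-n06-l's gated composite `linCovIterC` IS
`ℂ`-linear at every background (`B7Prop4LinCovIterClosed.linCovIterC_smul`) and equals `linCovIter` in the regime (`linCovIterC_eq_linCovIter_of_prop2`), so scaling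
`A ↦ tA` and letting `t → 0⁺` removes the quadratic term:
* §1 ★★ `norm_linCovIterC_le_of_prop2` — `‖LʲQ_j(U₀)A (c)‖ ≤ 2·Lʲ·b` for ALL `j ≤ k`, ALL `A` with `‖A‖ ≤ b`, `b ≥ 0` arbitrary, in the (52) regime of `U₀` with the one
  numeric condition `e^{4·800(d+1)²(d+4)α₀} < 2` on `α₀` (the shape of dag-n06-l's reality law (L4)); `norm_linCovIter_le_linear` — the same for `linCovIter`.
* §2 ★★ `norm_QknitY_apply_le` — `‖(QknitY i U a)(ι)‖ ≤ 2·b` whenever `‖a‖ ≤ b` on the fine bonds, for a `G`-valued member field `U` (`G` averaging-closed) whose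
  periodic lift is in the (52) regime at the member's top scale `k`: the factor `L^{−j(ι)}` of `QknitY_apply` cancels `Lʲ`, and the periodic lift `a♯` of the argument
  has the same sup (`liftBd_apply`).  This is the SIZE of print's `Q_j(U)` ((3.15)) at the knit letter, in the (52) currency; the record-currency face (keyed to the
  member's local class `Reg335`, per №375) is the consumer's one-line composition with dag-n06-l's per-index-bond retraction (his `…_of_reg335P` pattern).

HONEST SCOPE ∕ NOT CLAIMED.  A corollary of the LANDED Proposition 4 (`prop4_general`) by linearity and a limit `t → 0⁺`; no new estimate of [5]∕[B9] is proved from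
scratch; the regime ((52) at scale `k`, `G` averaging-closed, `α₀` small) is a HYPOTHESIS exactly as in dag-n06-l's `QknitY_gradY_GpY_RY_parKnitY`; the bound `2`
is print's (130) constant, not optimal (`Q_j(1)` is a contraction).  (L7) of the law bundle is NOT thereby discharged at the record (the `Reg335`-keyed face and
node00-def-Y's field text come next); count-neutral; N06 NOT discharged; nothing continuum ∕ OS ∕ mass gap ∕ Clay.  NEW file; 0 `def`, no `sorry`, no `axiom`, no
`instance`, no `notation`.  Cell `pub-ymgap` (D-0062), seat `pub-ymgap-dag-n06-c` (gen 23), 2026-08-30; `--supports stmt-QuantumFields-27364`.  Net new unproved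
facts: 0.

RELATED IN THE TREE, NOT DUPLICATED (searched 2026-08-30: `rg` for the basename and the decl names — 0 hits; nearest by content): `B7Eq136SecondOrderSkewAdjoint.norm_linCovIter_le`
(C\*-algebra setting, WITH the field smallness and the quadratic term — the statement this file sharpens by linearity), `B8Ineq159TowerNearFlat.norm_linCovIter_sub_flat_le`
(`(2L)ʲb`, near-flat backgrounds — not uniform in `j` after the `L^{−j}`), `B7Prop7BackgroundModulusLevels.norm_linCovIter_sub_flat_le` (sup-flat backgrounds, field
small), `B7Prop3GeneralLinearBound.norm_linQcov_le` (one step).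
-/

noncomputable section

open scoped BigOperators
open NormedSpace Finset

namespace Literature.MathematicalPhysics.QuantumFieldTheory.Balaban1983to89.B7Prop4LinCovIterLinearBound

open B7Prop1Explicit B7Prop2Explicit B7Prop3Flat B7Prop4GeneralLevels
open B7Eq123General (prop4_general)
open B7Prop4LinCovIterClosed (linCovIterC linCovIterC_smul linCovIterC_eq_linCovIter_of_prop2 linCovIterC_apply_zero)

-- `Site` alone would resolve to the torus sites of `Setup.lean`; re-export the `ℤ^d` sites of `B7Prop1Explicit`.
export B7Prop1Explicit (Site)

variable {d : ℕ}

/-! ## §1 The linear part is bounded by `2·Lʲ·‖A‖∞` for every field, in the (52) regime -/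

section Linear

variable {𝔸 : Type*} [NormedRing 𝔸] [NormedAlgebra ℂ 𝔸] [NormOneClass 𝔸] [CompleteSpace 𝔸]

/-- ★★ **THE ITERATED LINEARISED AVERAGE IS BOUNDED BY `2Lʲ‖A‖∞` FOR EVERY FIELD** ([5] Prop. 4 (130)–(131) read for the linear part): for `U₀` in Proposition 2's class
(`G`-valued, `G` averaging-closed, `pdev U₀ < α₀L^{−2k}`, `C₀α₀ ≤ 1∕3`, `4α₀ ≤ c₂′`) and `e^{4·800(d+1)²(d+4)α₀} < 2`, every field `A` with `‖A‖ ≤ b` (ANY `b ≥ 0`) has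
`‖linCovIterC L U₀ A j z κ‖ ≤ 2·Lʲ·b` for all `j ≤ k`.  PROOF: for small `t > 0` the field `tA` meets Proposition 4's smallness, so `‖LʲQ_j(U₀)(tA)‖ ≤ ‖log‖ + ‖log − lin‖ ≤
2Lʲtb + C(Lʲtb)²`; the gated composite is `ℂ`-linear (`linCovIterC_smul`) and equals `linCovIter` in the regime, so dividing by `t` and letting `t → 0⁺` gives the claim.
[cite: Balaban1985Averaging, Proposition 4 (130)–(131) p.38, (122) p.36, (127) p.37; Balaban1985BackgroundPropagators, (3.14)–(3.15) p.393] -/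
theorem norm_linCovIterC_le_of_prop2 (L : ℕ) (hL : 2 ≤ L) {G : Subgroup 𝔸ˣ} (hG : AvgClosed d L G) (k : ℕ)
    (U₀ : Site d → Fin d → 𝔸ˣ) (hU₀ : ∀ x κ, U₀ x κ ∈ G) {α₀ : ℝ} (hα : 0 < α₀)
    (hα3 : C0 d * α₀ ≤ 1 / 3) (hα4 : 4 * α₀ ≤ c2' d L) (h52 : pdev U₀ < α₀ * (((L : ℝ) ^ k)⁻¹) ^ 2)
    (hexp : Real.exp (4 * (800 * ((d : ℝ) + 1) ^ 2 * ((d : ℝ) + 4)) * α₀) < 2)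
    (A : Site d → Fin d → 𝔸) {b : ℝ} (hb : 0 ≤ b) (hA : ∀ x κ, ‖A x κ‖ ≤ b) :
    ∀ j ≤ k, ∀ (z : Site d) (κ : Fin d), ‖linCovIterC L U₀ A j z κ‖ ≤ 2 * ((L : ℝ) ^ j * b) := by
  intro j hj z κ
  have hα2 : 2 * α₀ ≤ c2' d L := by linarith
  have hL1 : 1 ≤ L := le_trans (by norm_num) hL
  -- abbreviations for the constants of Proposition 4
  set E : ℝ := Real.exp (4 * (800 * ((d : ℝ) + 1) ^ 2 * ((d : ℝ) + 4)) * α₀) with hE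
  set K : ℝ := 8 * (131072 * ((d : ℝ) + 1) ^ 2) with hK
  have hE0 : 0 < E := Real.exp_pos _
  have hK0 : 0 < K := by rw [hK]; positivity
  have hLk : 0 < (L : ℝ) ^ k := pow_pos (by exact_mod_cast lt_of_lt_of_le (by norm_num) hL) k
  have hLj : 0 ≤ (L : ℝ) ^ j := pow_nonneg (Nat.cast_nonneg L) j
  have hc3 : 0 < c3 d L := c3_pos d hL1
  set X : 𝔸 := linCovIterC L U₀ A j z κ with hX
  -- the case `b = 0`: the field vanishes
  rcases hb.eq_or_lt with hb0 | hbpos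
  · have hA0 : A = 0 := funext fun x => funext fun κ' => by
      have h := hA x κ'
      rw [← hb0] at h
      exact norm_le_zero_iff.1 h
    rw [hX, hA0, linCovIterC_apply_zero]
    simp [← hb0]
  -- the scaled bound: for `0 < t ≤ t₀`, `‖X‖ ≤ 2Lʲb + K·E·L^{2j}b²·t`
  have hscaled : ∀ t : ℝ, 0 < t → E * (1 + K * ((L : ℝ) ^ k * (t * b))) ≤ 2 → 2 * ((L : ℝ) ^ k * (t * b)) ≤ c3 d L →
      ‖X‖ ≤ 2 * ((L : ℝ) ^ j * b) + K * E * ((L : ℝ) ^ j) ^ 2 * b ^ 2 * t := by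
    intro t ht hsm hc
    have htb : 0 ≤ t * b := mul_nonneg ht.le hb
    have htA : ∀ x κ', ‖((t : ℂ) • A) x κ'‖ ≤ t * b := fun x κ' => by
      rw [Pi.smul_apply, Pi.smul_apply, norm_smul, Complex.norm_real, Real.norm_eq_abs, abs_of_pos ht]
      exact mul_le_mul_of_nonneg_left (hA x κ') ht.le
    obtain ⟨h1, h2⟩ := prop4_general L hL hG k U₀ hU₀ hα hα3 hα4 h52 ((t : ℂ) • A) htb htA hsm hc j hj
    -- `lin = log − (log − lin)` for the field `tA`, and `lin(tA) = t·lin(A) = t·X` in the regime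
    have hlinC : linCovIterC L U₀ ((t : ℂ) • A) j z κ = (t : ℂ) • X := by
      have h := congrFun (congrFun (linCovIterC_smul L U₀ (t : ℂ) A j) z) κ
      rw [h, hX]
      rfl
    have hlin : linCovIter L U₀ ((t : ℂ) • A) j z κ = (t : ℂ) • X := by
      rw [← hlinC, linCovIterC_eq_linCovIter_of_prop2 L U₀ hL hG k hU₀ hα hα3 hα2 h52 ((t : ℂ) • A) j hj]
    have htri : ‖linCovIter L U₀ ((t : ℂ) • A) j z κ‖ ≤
        2 * ((L : ℝ) ^ j * (t * b)) + K * E * ((L : ℝ) ^ j * (t * b)) ^ 2 := by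
      have h3 : ‖linCovIter L U₀ ((t : ℂ) • A) j z κ‖ ≤ ‖logCovIter L U₀ ((t : ℂ) • A) j z κ‖ +
          ‖logCovIter L U₀ ((t : ℂ) • A) j z κ - linCovIter L U₀ ((t : ℂ) • A) j z κ‖ := by
        have := norm_sub_le (logCovIter L U₀ ((t : ℂ) • A) j z κ) (logCovIter L U₀ ((t : ℂ) • A) j z κ - linCovIter L U₀ ((t : ℂ) • A) j z κ)
        rwa [sub_sub_cancel] at this
      exact h3.trans (add_le_add (h2 z κ) ((h1 z κ).trans_eq (by simp only [hK, hE])))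
    rw [hlin, norm_smul, Complex.norm_real, Real.norm_eq_abs, abs_of_pos ht] at htri
    -- divide by `t`
    have hdiv : ‖X‖ ≤ (2 * ((L : ℝ) ^ j * (t * b)) + K * E * ((L : ℝ) ^ j * (t * b)) ^ 2) / t := by
      rw [le_div_iff₀ ht, mul_comm]; exact htri
    refine hdiv.trans (le_of_eq ?_)
    rw [div_eq_iff ht.ne']
    ring
  -- a threshold `t₀ > 0` below which the smallness conditions hold for `tA`
  have hgap : 0 < 2 - E := by linarith
  set t₀ : ℝ := min ((2 - E) / (E * K * ((L : ℝ) ^ k * b))) (c3 d L / (2 * ((L : ℝ) ^ k * b))) with ht₀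
  have hLkb : 0 < (L : ℝ) ^ k * b := mul_pos hLk hbpos
  have ht₀pos : 0 < t₀ := by
    rw [ht₀]; exact lt_min (by positivity) (by positivity)
  have hsm_of : ∀ t : ℝ, 0 < t → t ≤ t₀ → E * (1 + K * ((L : ℝ) ^ k * (t * b))) ≤ 2 ∧ 2 * ((L : ℝ) ^ k * (t * b)) ≤ c3 d L := by
    intro t ht htle
    have ht1 : t ≤ (2 - E) / (E * K * ((L : ℝ) ^ k * b)) := htle.trans (min_le_left _ _)
    have ht2 : t ≤ c3 d L / (2 * ((L : ℝ) ^ k * b)) := htle.trans (min_le_right _ _)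
    constructor
    · have hden : 0 < E * K * ((L : ℝ) ^ k * b) := by positivity
      have h1 : E * K * ((L : ℝ) ^ k * b) * t ≤ 2 - E := by
        have := (le_div_iff₀ hden).1 ht1
        linarith [this]
      have : E * (1 + K * ((L : ℝ) ^ k * (t * b))) = E + E * K * ((L : ℝ) ^ k * b) * t := by ring
      rw [this]; linarith
    · have hden : 0 < 2 * ((L : ℝ) ^ k * b) := by positivity
      have h1 : 2 * ((L : ℝ) ^ k * b) * t ≤ c3 d L := by
        have := (le_div_iff₀ hden).1 ht2
        linarith [this]
      have : 2 * ((L : ℝ) ^ k * (t * b)) = 2 * ((L : ℝ) ^ k * b) * t := by ring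
      rw [this]; exact h1
  -- the limit `t → 0⁺`
  refine le_of_forall_pos_le_add fun ε hε => ?_
  set C : ℝ := K * E * ((L : ℝ) ^ j) ^ 2 * b ^ 2 with hC
  have hC0 : 0 ≤ C := by rw [hC]; positivity
  set t : ℝ := min t₀ (ε / (C + 1)) with htdef
  have htpos : 0 < t := lt_min ht₀pos (by positivity)
  have htle : t ≤ t₀ := min_le_left _ _
  obtain ⟨hsm, hc⟩ := hsm_of t htpos htle
  have h := hscaled t htpos hsm hc
  have hCt : C * t ≤ ε := by
    have ht2 : t ≤ ε / (C + 1) := min_le_right _ _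
    have hC1 : 0 < C + 1 := by linarith
    calc C * t ≤ C * (ε / (C + 1)) := mul_le_mul_of_nonneg_left ht2 hC0
      _ ≤ (C + 1) * (ε / (C + 1)) := mul_le_mul_of_nonneg_right (by linarith) (by positivity)
      _ = ε := by field_simp
  calc ‖X‖ ≤ 2 * ((L : ℝ) ^ j * b) + K * E * ((L : ℝ) ^ j) ^ 2 * b ^ 2 * t := h
    _ = 2 * ((L : ℝ) ^ j * b) + C * t := by rw [hC]
    _ ≤ 2 * ((L : ℝ) ^ j * b) + ε := by linarith

/-- ★ the same bound for the (ungated) `linCovIter` of `B7Prop4GeneralLevels` — equal to the gated composite in the regime.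
[cite: Balaban1985Averaging, Proposition 4 (130)–(131) p.38, p.37 (after (127))] -/
theorem norm_linCovIter_le_linear (L : ℕ) (hL : 2 ≤ L) {G : Subgroup 𝔸ˣ} (hG : AvgClosed d L G) (k : ℕ)
    (U₀ : Site d → Fin d → 𝔸ˣ) (hU₀ : ∀ x κ, U₀ x κ ∈ G) {α₀ : ℝ} (hα : 0 < α₀)
    (hα3 : C0 d * α₀ ≤ 1 / 3) (hα4 : 4 * α₀ ≤ c2' d L) (h52 : pdev U₀ < α₀ * (((L : ℝ) ^ k)⁻¹) ^ 2)
    (hexp : Real.exp (4 * (800 * ((d : ℝ) + 1) ^ 2 * ((d : ℝ) + 4)) * α₀) < 2)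
    (A : Site d → Fin d → 𝔸) {b : ℝ} (hb : 0 ≤ b) (hA : ∀ x κ, ‖A x κ‖ ≤ b) :
    ∀ j ≤ k, ∀ (z : Site d) (κ : Fin d), ‖linCovIter L U₀ A j z κ‖ ≤ 2 * ((L : ℝ) ^ j * b) := by
  intro j hj z κ
  have hα2 : 2 * α₀ ≤ c2' d L := by linarith
  rw [← linCovIterC_eq_linCovIter_of_prop2 L U₀ hL hG k hU₀ hα hα3 hα2 h52 A j hj]
  exact norm_linCovIterC_le_of_prop2 L hL hG k U₀ hU₀ hα hα3 hα4 h52 hexp A hb hA j hj z κ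

end Linear

/-! ## §2 The size of the knit averaging letter `QknitY` ((3.15) at print's `Q_j(U)`), (52) currency -/

section Knit

open B6KLevelCensusIndexV1 (KIdx)
open B9B8CarrierDictionary (liftCfg liftCfg_mem)
open B9B8KnitBondTransfer (liftBd liftBd_apply)
open B9Eq3115KnitLetterY (QknitY QknitY_apply zSrc lvl_le')
open Node00 (FBondY IBondY CfgY)

variable {ℓ : ℕ} {hd : 1 ≤ d + 1} {hL : Odd (ℓ + 1) ∧ 1 < ℓ + 1} {b₀ b₁ : ℝ}
variable {𝔸 : Type} [NormedRing 𝔸] [NormOneClass 𝔸] [NormedAlgebra ℂ 𝔸] [CompleteSpace 𝔸]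
variable (i : KIdx d ℓ hd hL b₀ b₁)

omit [NormOneClass 𝔸] [NormedAlgebra ℂ 𝔸] [CompleteSpace 𝔸] in
/-- the periodic lift of a bond function has the same sup bound. [cite: Balaban1985RegularSpaces, p.77 (periodic extension), bookkeeping] -/
theorem norm_liftBd_le_of_forall (a : FBondY i → 𝔸) {b : ℝ} (ha : ∀ f, ‖a f‖ ≤ b) (z : Site (d + 1)) (μ : Fin (d + 1)) : ‖liftBd i a z μ‖ ≤ b := by
  rw [liftBd_apply]; exact ha _

/-- ★★ **THE SIZE OF PRINT's AVERAGING LETTER `Q_j(U)` AT THE KNIT REALISATION, (52) CURRENCY** ((3.15) p. 393; [5] Prop. 4 (130) for the linear part): for a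
`G`-valued member field `U` (`G` averaging-closed) whose periodic lift `U♯` has plaquette deviations `< α₀L^{−2k}` at the member's top scale `k`, with `C₀α₀ ≤ 1∕3`,
`4α₀ ≤ c₂′` and `e^{4·800(d+2)²(d+5)α₀} < 2` (dimension `d + 1`), the knit average does not more than double sup norms: `‖a‖ ≤ b` on the fine bonds ⇒
`‖(QknitY i U a)(ι)‖ ≤ 2b` at every index bond `ι` (the `L^{−j(ι)}` of the letter against §1's `Lʲ`, `j(ι) ≤ k`).
[cite: Balaban1985BackgroundPropagators, (3.12)–(3.15) p.393; Balaban1985Averaging, Proposition 4 (130) p.38, (52) p.26] -/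
theorem norm_QknitY_apply_le {G : Subgroup 𝔸ˣ} (hG : AvgClosed (d + 1) (ℓ + 1) G) {U : CfgY 𝔸 i} (hU : ∀ μ x, U μ x ∈ G)
    {α₀ : ℝ} (hα : 0 < α₀) (hα3 : C0 (d + 1) * α₀ ≤ 1 / 3) (hα4 : 4 * α₀ ≤ c2' (d + 1) (ℓ + 1))
    (h52 : pdev (liftCfg U) < α₀ * ((((ℓ + 1 : ℕ) : ℝ) ^ i.k)⁻¹) ^ 2)
    (hexp : Real.exp (4 * (800 * (((d + 1 : ℕ) : ℝ) + 1) ^ 2 * (((d + 1 : ℕ) : ℝ) + 4)) * α₀) < 2)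
    (a : FBondY i → 𝔸) {b : ℝ} (hb : 0 ≤ b) (ha : ∀ f, ‖a f‖ ≤ b) (ι : IBondY i) :
    ‖QknitY i U a ι‖ ≤ 2 * b := by
  have hLpos : (0 : ℝ) < ((ℓ + 1 : ℕ) : ℝ) := by exact_mod_cast Nat.succ_pos ℓ
  have hLj : (0 : ℝ) < ((ℓ + 1 : ℕ) : ℝ) ^ (ι.1.1 : ℕ) := pow_pos hLpos _
  have hlin := norm_linCovIterC_le_of_prop2 (ℓ + 1) hL.2 hG i.k (liftCfg U) (fun x κ => liftCfg_mem hU x κ) hα hα3 hα4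
    (by exact_mod_cast h52) hexp (liftBd i a) hb (norm_liftBd_le_of_forall i a ha) (ι.1.1 : ℕ) (lvl_le' i ι) (zSrc i ι) ι.1.2.dir
  rw [QknitY_apply, norm_smul, Complex.norm_real, Real.norm_eq_abs, abs_inv, abs_of_pos hLj]
  have hcast : (((ℓ + 1 : ℕ) : ℕ) : ℝ) ^ (ι.1.1 : ℕ) = ((ℓ + 1 : ℕ) : ℝ) ^ (ι.1.1 : ℕ) := by norm_cast
  calc (((ℓ + 1 : ℕ) : ℝ) ^ (ι.1.1 : ℕ))⁻¹ * ‖linCovIterC (ℓ + 1) (liftCfg U) (liftBd i a) (ι.1.1 : ℕ) (zSrc i ι) ι.1.2.dir‖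
      ≤ (((ℓ + 1 : ℕ) : ℝ) ^ (ι.1.1 : ℕ))⁻¹ * (2 * ((((ℓ + 1 : ℕ) : ℕ) : ℝ) ^ (ι.1.1 : ℕ) * b)) :=
        mul_le_mul_of_nonneg_left hlin (inv_nonneg.2 hLj.le)
    _ = 2 * b := by rw [hcast]; field_simp

end Knit

end Literature.MathematicalPhysics.QuantumFieldTheory.Balaban1983to89.B7Prop4LinCovIterLinearBound

end
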